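import Summits.RiemannHypothesis.RiemannHypothesis.Theorems.MotivicDoorFunctionFieldPrime

/-!
# The function-field door, part 11: the instance `(p, x² + p)` — exponent ONE over `𝔽_p`, outside (HO)

FF-DOOR statement (ii), pub-rhdoor seat ff-2 (gen 4).  HONEST FRAMING (verbatim, binding): lottery ticket
at the motivic door; RH probability negligible; consolation prizes are real: a new semi-local
Weil-positivity theorem, or a located gap in the Connes–Consani programme, plus the ff-door theorem.
Nothing in this file is a statement about `ζ`.

The simplest honest RH-true datum is `(q, x² + q)` (`g = 1`, roots `± i√q`, `c₀ = q`, middle coefficient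
`0`).  Its powers are the witness family of `geo_hlarge` (part 3).  This file records what the doors of
parts 6 and 10 say about the datum ITSELF, with every hypothesis explicit:

* [PROVED, fact-free] `X_sq_add_C_shape`, `fe_X_sq_add_C` (honest of dimension `1`),
  `not_isOrdinaryWeilPoly_X_sq_add_C` — the middle coefficient is `0`, so the datum is NOT an ordinary
  Weil polynomial for any `p`: the ordinary door (part 6, named fact (HO)) is silent about it.
* [PROVED from (HT)] `exists_pow_geometric_X_sq_add_C` — over ANY finite field some power `(x² + q)^E`,
  `E ≥ 1`, is a characteristic polynomial of Frobenius (the general door, part 1).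
* [PROVED from (HTP)] `geometric_X_sq_add_C_prime` — over a PRIME field `#K = p` the datum itself is
  `P_A` for an abelian variety `A` of dimension `1` (exponent ONE, prime-field door of part 10), and
  `forall_pow_geometric_X_sq_add_C_prime` — every exponent `E ≥ 1` is admissible.
* [PROVED from (W) + (HTP) + the explicit inline hypothesis (P0) of part 9] `sign_dichotomy_X_sq_prime` —
  at the same prime `p` the two RH-true data `x² + p` and `x² - p` (equal window towers up to the sign
  pattern, both with middle coefficient `0`) sit on opposite sides of the door at exponent one:
  `x² + p` IS a `P_A`, `x² - p` is the `P_A` of NO abelian variety over `𝔽_p` (its admissible exponents are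
  exactly the even ones, part 10 `geometric_pow_X_sq_sub_C_iff_even_prime`).

PRINTED cross-check, not used in any proof: an elliptic curve over `𝔽_q`, `q = p^a`, with trace `0`
exists whenever `a` is odd [Waterhouse 1969, Thm. 4.1 (5)(i), p. 537; held `paper:doi-10-24033-asens-1183`],
in particular over every prime field; such curves are supersingular.  No novelty is claimed: the value is
the kernel-checked instance with its exact hypothesis split ((HT) vs (HTP) vs (HO)).
-/

open Polynomial
open scoped ComplexOrder
open Summit.RiemannHypothesis.RiemannHypothesis.Theorems.PfPersistence.FfAngleTwin
open Literature.AlgebraicGeometry.Motives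

namespace Summit.RiemannHypothesis.RiemannHypothesis.Theorems.MotivicDoor.FunctionField

set_option linter.dupNamespace false  -- the mandated namespace repeats `RiemannHypothesis`

universe u

/-! ## The datum `(q, x² + q)`: shape, functional equation, non-ordinarity (fact-free) -/

/-- `x² + q` is monic of degree `2` with `c₀ = q` and middle coefficient `c₁ = 0`. [PROVED] -/
theorem X_sq_add_C_shape (q : ℤ) :
    (X ^ 2 + C q : ℤ[X]).Monic ∧ (X ^ 2 + C q : ℤ[X]).natDegree = 2 ∧
      (X ^ 2 + C q : ℤ[X]).coeff 0 = q ∧ (X ^ 2 + C q : ℤ[X]).coeff 1 = 0 := by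
  refine ⟨monic_X_sq_add_C q, natDegree_X_sq_add_C q, ?_, ?_⟩
  · rw [coeff_add, coeff_X_pow, coeff_C]; simp
  · rw [coeff_add, coeff_X_pow, coeff_C]; simp

/-- `(q, x² + q)` is honest of dimension `1`: `q^1 · c_j = q^i · c_i` for `i + j = 2`. [PROVED; the `m = 1`
case of part 3's `fe_X_sq_add_C_pow`] -/
theorem fe_X_sq_add_C (q : ℕ) :
    ∀ i j, i + j = 2 * 1 →
      (q : ℤ) ^ 1 * (X ^ 2 + C (q : ℤ) : ℤ[X]).coeff j = (q : ℤ) ^ i * (X ^ 2 + C (q : ℤ) : ℤ[X]).coeff i := by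
  intro i j hij
  simpa only [pow_one] using fe_X_sq_add_C_pow (q : ℤ) 1 i j hij

/-- `x² + q` is NOT an ordinary Weil `q`-polynomial, for any `p`: its middle coefficient is `0`, which
every `p` divides (Howe Def. (3.2)(b) fails).  So the ordinary door of part 6 (named fact (HO)) says
nothing about this datum. [PROVED, fact-free] -/
theorem not_isOrdinaryWeilPoly_X_sq_add_C (p q : ℕ) : ¬ IsOrdinaryWeilPoly p q (X ^ 2 + C (q : ℤ)) := by
  refine not_isOrdinaryWeilPoly_of_dvd_coeff_half ?_
  obtain ⟨-, hd, -, h1⟩ := X_sq_add_C_shape (q : ℤ)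
  rw [hd, show 2 / 2 = 1 from rfl, h1]
  exact dvd_zero _

/-! ## Over any finite field: geometric up to a power (named fact (HT)) -/

variable {K : Type u} [Field K] [Finite K]

/-- Over ANY finite field `K`, `q = #K`: some power `(x² + q)^E`, `E ≥ 1`, is the characteristic
polynomial of the Frobenius of an abelian variety over `K` (the general door, part 1, `⇒` direction).
[PROVED from hHT] -/
theorem exists_pow_geometric_X_sq_add_C (hHT : AbelianVariety.hondaTateExistence K) :
    ∃ E : ℕ, 0 < E ∧ ∃ C : AbelianVariety K, C.IsFrobCharpoly ((X ^ 2 + Polynomial.C (Nat.card K : ℤ)) ^ E) :=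
  exists_pow_geometric_of_rh hHT (monic_X_sq_add_C (Nat.card K : ℤ))
    (by rw [natDegree_X_sq_add_C]; exact two_pos) (frobRoots_norm_eq_of_X_sq_add_C (Nat.card K))

/-! ## Over a prime field: exponent ONE (named fact (HTP)) -/

/-- **The instance `(p, x² + p)` of the prime-field door.**  Over `K` with `#K = p` prime, `x² + p` IS the
characteristic polynomial of the Frobenius of an abelian variety of dimension `1` over `K` — exponent ONE,
although the datum is not ordinary (`not_isOrdinaryWeilPoly_X_sq_add_C`).  [PROVED from hHTP; PRINTED
cross-check: a trace-`0` elliptic curve exists over every prime field, Waterhouse 1969 Thm. 4.1 (5)(i)] -/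
theorem geometric_X_sq_add_C_prime (hHTP : AbelianVariety.hondaTatePrimeField K)
    (hp : (Nat.card K).Prime) :
    ∃ A : AbelianVariety K, A.dim = 1 ∧ A.IsFrobCharpoly (X ^ 2 + Polynomial.C (Nat.card K : ℤ)) :=
  geometric_of_rh_prime hHTP hp one_pos (monic_X_sq_add_C (Nat.card K : ℤ))
    ((natDegree_X_sq_add_C (Nat.card K : ℤ)).trans (by norm_num)) (fe_X_sq_add_C (Nat.card K))
    (frobRoots_norm_eq_of_X_sq_add_C (Nat.card K))

/-- Over a prime field EVERY exponent `E ≥ 1` of `x² + p` is admissible: `(x² + p)^E = P_{A^E}`.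
[PROVED from hHTP] -/
theorem forall_pow_geometric_X_sq_add_C_prime (hHTP : AbelianVariety.hondaTatePrimeField K)
    (hp : (Nat.card K).Prime) {E : ℕ} (hE : 0 < E) :
    ∃ C : AbelianVariety K, C.IsFrobCharpoly ((X ^ 2 + Polynomial.C (Nat.card K : ℤ)) ^ E) :=
  forall_pow_geometric_of_fe_prime hHTP hp one_pos (monic_X_sq_add_C (Nat.card K : ℤ))
    ((natDegree_X_sq_add_C (Nat.card K : ℤ)).trans (by norm_num)) (fe_X_sq_add_C (Nat.card K))
    (frobRoots_norm_eq_of_X_sq_add_C (Nat.card K)) hE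

/-- **Sign dichotomy at exponent one, same prime.**  Over `K` with `#K = p` prime, under (W), (HTP) and
the explicit inline hypothesis (P0) `P_A(0) > 0` of part 9: `x² + p` is a `P_A`, while `x² - p` — RH-true
with the same root moduli and the same vanishing middle coefficient, but `c₀ = -p` — is the characteristic
polynomial of NO abelian variety over `K` (its admissible exponents are exactly the even ones, part 10).
[PROVED from hW, hHTP and the explicit hypothesis (P0)] -/
theorem sign_dichotomy_X_sq_prime (hW : ∀ A : AbelianVariety K, A.weilRiemannHypothesis)
    (hHTP : AbelianVariety.hondaTatePrimeField K)
    (hP0 : ∀ (A : AbelianVariety K) (P : ℤ[X]), 0 < A.dim → A.IsFrobCharpoly P → 0 < P.coeff 0)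
    (hp : (Nat.card K).Prime) :
    (∃ A : AbelianVariety K, A.IsFrobCharpoly (X ^ 2 + Polynomial.C (Nat.card K : ℤ))) ∧
      ∀ A : AbelianVariety K, ¬ A.IsFrobCharpoly (X ^ 2 - Polynomial.C (Nat.card K : ℤ)) := by
  refine ⟨?_, fun A => ?_⟩
  · obtain ⟨A, -, hA⟩ := geometric_X_sq_add_C_prime hHTP hp
    exact ⟨A, hA⟩
  · obtain ⟨-, hdeg, hc0, -⟩ := X_sq_sub_C_shape (Nat.card K : ℤ)
    exact not_isFrobCharpoly_of_coeff_zero_eq_neg hW hP0 one_pos (hdeg.trans (by norm_num))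
      (by rw [hc0, pow_one]) A

end Summit.RiemannHypothesis.RiemannHypothesis.Theorems.MotivicDoor.FunctionField
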